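import Mathlib
import HarnessLib
import HarnessLib.Audit
import Summits.SmoothPoincare4.Statement
import Literature.Topology.FourManifolds.Morse
import HarnessLib.Audit.Status.Attr

/-!
Route: ConvexityLadder

DORMANT since 2026-08-23T04:07:54Z (reconciler: no traction for 5.9 d (last activity item-evidence-added at 2026-08-17T06:15:11Z); parked, not closed — `ledger route dormant route-SmoothPoincare4-ConvexityLadder --off` to reactivate) — unstaffed, not closed; items shared with open routes are served there. `ledger route dormant <id> --off` reactivates.

# Route ConvexityLadder — k-convexity ladder in ℝ⁵ — every homotopy 4-sphere 3-convexly embedded,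
every 3-convex one standard

It suffices to show X = X₁ ∧ T (card extrinsic-convexity-ladder, which absorbed
saddle-gap-total-absolute-curvature). Present a closed
hypersurface Σ ⊂ ℝ⁵ as the regular zero set of a smooth F : ℝ⁵ → ℝ with compact region Ω = {F ≤ 0};
Σ is k-CONVEX when at every point the
sum of the k smallest eigenvalues of D²F on the tangent hyperplane ker DF is positive (Ky Fan form:
Σᵢ D²F(vᵢ,vᵢ) > 0 for every orthonormal
tangent k-frame; sign fixed by the inward normal −∇F; k = 2 two-convex, k = 4 mean-convex); conv(Σ)
:= the least such k over all embeddings.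
X₁ (CvxThreeConvexEmbeds, rank 2): every homotopy 4-sphere admits a 3-convex embedding into ℝ⁵. T
(PresentationSpheresStandard, rank 3, the
item SHARED verbatim with route EntropyLadder): a homotopy 4-sphere bounding a compact contractible
5-manifold with an adapted Morse function of
index ≤ 2 (a presentation sphere ∂H⁵(P)) is S⁴; its first open sector
TwoGeneratorPresentationSpheres (≤ 2 one-handles) is rank 4. The bridge
X₁-datum ⇒ "bounds a contractible 2-handlebody" is height-function Morse theory (support
CvxThreeConvexBoundsTwoHandlebody, a theorem, no flow and
no genericity conjecture), and the rungs 2-convex ⇒ S⁴, ≤ 4 Morse critical points ⇒ S⁴, mean-convex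
representatives exist are filed as support;
so conv ∈ {2,3,4}, SPC4 ⇔ conv ≡ 2 ⇔ X. All items use the bare quantifier shape of the summit
statement (M ≃ₕ S⁴), so no packaging facts enter.
Lean: `CvxThreeConvexEmbeds ∧ PresentationSpheresStandard`

## Assembly
Pure logic: `SmoothPoincare4` unfolds (Literature.SPC4.SmoothPoincareConjectureFour,
HomotopyEquiv.NonemptyDiffeomorphSphere) to the bare shape
∀ M ≃ₕ S⁴, Nonempty (M ≃ₘ S⁴); X₁ gives (F, e), the bridge gives Bounds₂(M), T gives the
diffeomorphism. Checked: `theorem assembly_proof :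
Assembly := by intro hE hB hT M _ _ _ cs im e; obtain ⟨F, emb, hF, hK, hreg, he, hr, hcvx⟩ := hE M
e; exact hT M e (hB M e F emb hF hK hreg he hr
hcvx)` compiles in the planner's Sk/Sketch.lean (lean check rc 0, axioms propext / Classical.choice
/ Quot.sound, 2026-08-15), as do the glues
bridge → T → CvxThreeConvexStandard and T → TwoGeneratorPresentationSpheres. Conversely SPC4 ⇒ X (S⁴
= ∂B⁵ with F = |x|² − 1 is k-convex for
every k; B⁵ is a 0-handlebody), so X ⇔ SPC4.

Rationale: WHY THIS LINE. Mechanism (1950s–80s Morse theory, no flow): for a linear height function on Ω only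
the Ω-inward horizontal points of Σ attach handles, of index =
number of negative principal curvatures there, so a k-convex Σ bounds a (k−1)-handlebody (Sha1986;
ChernLashof1957; restated arXiv:1111.3895 p.6):
2-convex ⇒ Ω = ♮(S¹×B⁴) with simply connected boundary ⇒ Ω ≅ B⁵ ⇒ Σ ≅ S⁴ (by flow:
HuiskenSinestrari2008); 3-convex ⇒ Ω is a contractible
5-dimensional 2-handlebody H⁵(P), Σ = ∂H⁵(P) = D(W) a presentation sphere (AndrewsCurtis1965,
AkbulutKirby1985, arXiv:1803.06713 §1.2); and every
embedded Σ has a mean-convex representative (LawsonMichelsohn1984 after trading 4-handles in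
dimension 5). Imported area: extrinsic and integral
geometry of hypersurfaces (the k-convexity classes of mean-curvature-flow surgery,
BuzanoHaslhoferHershkovits2021 gluing/moduli technology,
Chern–Lashof total curvature) brought to bear on the handle structure of the 5-DIMENSIONAL
null-cobordism Ω, where attaching circles cannot knot.
Versus route EntropyLadder (same strata, Colding–Minicozzi entropy as currency): its passage "thin ⇒
bounds a 2-handlebody" (crux G) needs generic
nondegeneracy of cylindrical MCF singularities (Sun–Wang–Xue Conj. 1.4), whereas the convexity
bridge is a theorem, so the rung theorem
"3-convex embedded homotopy 4-spheres are S⁴" reduces to T ALONE; the two existence halves (their E,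
our X₁) are both equivalent to "Σ bounds a
contractible 2-handlebody" modulo glue (theirs proved, ours the k = 3 tube lemma), and T is one
ledger item wanted by both routes. Versus
NoOneHandles / GroupTrisection / Stabilisation (handles ON the 4-manifold) and ConvexBisection
(contact convexity in S⁵): different object, flat ℝ⁵,
pointwise Riemannian condition checkable on explicit hypersurfaces.

RANKED CRUXES. #2 CvxThreeConvexEmbeds (crux) — every smooth 4-manifold M ≃ₕ S⁴ admits a 3-convex
embedding into ℝ⁵ — a smooth F : ℝ⁵ → ℝ with compact {F ≤ 0} and DF ≠ 0 on {F = 0}, a smooth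
embedding e : M → ℝ⁵ onto {F = 0}, and Σᵢ D²F(x)(vᵢ,vᵢ) > 0 for every x ∈ {F = 0} and every
orthonormal triple (v₁,v₂,v₃) ⊂ ker DF(x) (card crux I; ⇒ M bounds a contractible 5-dimensional
2-handlebody by the bridge, conversely modulo the k = 3 tube lemma; so X₁ ⇔ EntropyLadder's B ⇔ its
E modulo glue). [difficulty: open-problem] (why it might fail: Forces every homotopy 4-sphere to
bound a contractible 2-handlebody, i.e. to be a double D(W) with an orientation-reversing
involution; a Gluck-twist or zero-surgery sphere that is no presentation sphere (conv = 4) refutes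
it, and no engine (flow, closed-case h-principle) yet makes 3-convexity.) [Sha1986,
LawsonMichelsohn1984, AndrewsCurtis1965, AkbulutKirby1985, arXiv:1803.06713, arXiv:1111.3895]
#3 PresentationSpheresStandard (crux) — SHARED verbatim with route EntropyLadder
(stmt-SmoothPoincare4-3717, its crux T): a smooth 4-manifold M ≃ₕ S⁴ that bounds a compact
contractible smooth 5-manifold W carrying a Morse function adapted to ∂W with all critical points of
index ≤ 2 (`IsHandlebodyOfIndexLE 4 2 W` unfolded; W = H⁵(P,ε) for a balanced presentation P of the
trivial group) is diffeomorphic to S⁴. Equivalent: every compact contractible 5-dimensional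
2-handlebody is B⁵; doubles of contractible 4-dimensional 2-handlebodies are S⁴ (card
doubles-reflection-rung). Here it is the 3 → 2 transition of the convexity ladder (card crux II).
[difficulty: open-problem] (why it might fail: It is the 5-dimensional Andrews–Curtis problem: H⁵(P)
≅ B⁵ is known only for AC-trivial P and the Akbulut–Kirby family (Gompf 1991, Akbulut 2010); one
balanced presentation of the trivial group with exotic ∂H⁵(P) refutes it and SPC4 at once.)
[AndrewsCurtis1965, AkbulutKirby1985, Gompf1991Killing, Akbulut2010, GompfScharlemannThompson2010,
arXiv:1905.00809]
#4 TwoGeneratorPresentationSpheres (crux) — first open sector of T: the same with the adapted Morse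
function on W having exactly ONE critical point of index 0 and AT MOST TWO of index 1 (so W = B⁵ ∪ ≤
2 one-handles ∪ as many 2-handles, χ(W) = 1: the presentation spheres of balanced presentations of
the trivial group on ≤ 2 generators) ⇒ M ≅ S⁴. In convexity currency: 3-convex Σ whose some height
function has one Ω-inward minimum and ≤ 2 Ω-inward index-1 points. [deps:
PresentationSpheresStandard] [difficulty: L] (why it might fail: ≤ 1 generator is trivial, but
2-generator balanced presentations of the trivial group include AK(n) (spheres standard only by
Gompf 1991 / Akbulut 2010) and Miller–Schupp-type families expected AC-nontrivial whose spheres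
nobody has standardised; an exotic one is ¬SPC4.) [Akbulut2010, Gompf1991Killing,
GompfScharlemannThompson2010, MeierZupan2022, AkbulutKirby1985]
#9 CvxThreeConvexBoundsTwoHandlebody (support) — the BRIDGE (in the assembly; known mathematics,
long formalisation): if M ≃ₕ S⁴ carries the data (F, e) of a 3-convex embedding into ℝ⁵ then M
bounds a compact contractible smooth 5-manifold with an adapted Morse function of index ≤ 2
(EntropyLadder's Bounds₂(M), same spelling). Proof: Ω = {F ≤ 0} is a compact 5-manifold with ∂Ω = {F
= 0} = e(M); for a.e. direction a the height ⟨a,·⟩ is Morse on ∂Ω (Literature MorseHeightFunctions)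
with no interior critical points; passing an Ω-inward horizontal point (DF·a < 0) attaches a handle
of index = Morse index = number of negative eigenvalues of D²F|ker DF ≤ 2 by 3-convexity, other
horizontal points attach nothing (Sha1986 / Morse theory on manifolds with boundary); handles ⇒
adapted Morse function (Kosinski VII); Ω is contractible (van Kampen + Mayer–Vietoris in S⁵ = Ω ∪_Σ
Ω'). [difficulty: L] [Sha1986, Milnor1965, Matsumoto2001, GuilleminPollack2010, arXiv:1111.3895]
#9 CvxThreeConvexStandard (support) — the RUNG THEOREM of this route (= bridge ∧ T; glue
`CvxThreeConvexBoundsTwoHandlebody → PresentationSpheresStandard → CvxThreeConvexStandard` proved in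
Sketch.lean): a smooth 4-manifold M ≃ₕ S⁴ with a 3-convex embedding into ℝ⁵ is diffeomorphic to S⁴.
Publishable milestone independent of X₁; refuter-facing form of T in convexity currency.
[difficulty: open-problem] [Sha1986, AndrewsCurtis1965, Gompf1991Killing]
#9 CvxTwoConvexStandard (support) — rung (a): a 2-convexly embedded M ≃ₕ S⁴ in ℝ⁵ (orthonormal PAIRS
in the convexity clause) is diffeomorphic to S⁴ — height-function Morse theory makes Ω a
5-dimensional 1-handlebody ♮ₖ(S¹×B⁴) with simply connected boundary, so k = 0, Ω ≅ B⁵, M ≅ ∂B⁵;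
alternatively Huisken–Sinestrari's classification of closed 2-convex hypersurfaces (n = 4: S⁴ or
#(S³×S¹)). Known; long to formalise. [difficulty: L] [Sha1986, HuiskenSinestrari2008,
BuzanoHaslhoferHershkovits2021]
#9 CvxMorseFourStandard (support) — Morse-number rung under the card's crux III and the merged card
saddle-gap-total-absolute-curvature: a compact smooth M ≃ₕ S⁴ with a Morse function having finitely
many, at most 4, critical points is diffeomorphic to S⁴ (indices (0,2,3,4) or dual: the 2-handle's
framed knot has surgery S¹×S², so it is the 0-framed unknot by Property R, then Laudenbach–Poenaru;
2 critical points: Reeb + Cerf Γ₄ = 0). With Chern–Lashof (τ = mean number of height-function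
critical points) it yields τ ≥ 6, ∫|K| ≥ 3·vol(S⁴), for every immersion of an exotic 4-sphere —
recorded under Not decomposed yet. [difficulty: L] [Gabai1987, LaudenbachPoenaru1972, Cerf1968,
Reeb1952, ChernLashof1957, Sharpe1988]
#9 CvxMeanConvexRepresentative (support) — rung (c), top of the ladder: an M ≃ₕ S⁴ presented as a
compact regular zero set in ℝ⁵ also admits a MEAN-convex such presentation (orthonormal 4-frames:
trace of D²F on ker DF positive): Ω is contractible, its 4-handles are traded for 2-handles rel the
simply connected boundary (dimension 5), so Ω is a regular neighbourhood of a 3-complex, codimension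
2, and Lawson–Michelsohn surround it by a hypersurface of positive mean curvature. Hence conv ∈
{2,3,4} for every embedded homotopy 4-sphere. [difficulty: M] [LawsonMichelsohn1984, Milnor1965,
KervaireMilnor1963]

TWO-LAYER PLAN. Foreseen glued splits, none filed now (k ≤ 3, depth 1). T ⇐ T1 → T2 → T with T1 =
"H⁵(P,ε) ≅ B⁵ for Andrews–Curtis-trivial P" (tree
BalancedPresentation / IsAndrewsCurtisEquivalent library) and T2 = "every compact contractible
5-dimensional 2-handlebody is AC-trivially
presented OR standard by 2/3-pair cancellation with light-bulb isotopy of attaching 2-spheres in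
free-π₁ 4-manifolds" (card doubles-reflection-rung's
LEVER) — coordinated with EntropyLadder's tenure planner since T is shared. X₁ ⇐
EveryPresentationSphere (every M ≃ₕ S⁴ satisfies Bounds₂ =
EntropyLadder's support B) → TubeLemmaThree (the boundary of a compact 5-dimensional 2-handlebody in
ℝ⁵ is isotopic to a 3-convex hypersurface:
1- and 2-handle attachment preserving 3-convexity, after the Buzano–Haslhofer–Hershkovits 2-convex
1-handle gluing) → X₁. TwoGeneratorPresentationSpheres
⇐ family-by-family standardisation (AK(n) sits in the tree behind
Literature.Barriers.SmoothPoincare4.CappellShanesonFamilyBarrier) → a uniform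
2-generator argument.

KILL CRITERIA. T or TwoGeneratorPresentationSpheres refuted = an exotic presentation sphere = ¬SPC4:
close `refuted:PresentationSpheresStandard` together with
EntropyLadder and every positive route. X₁ cannot be refuted without ¬SPC4 (S⁴ = ∂B⁵ is 2-convex),
but the LINE dies softly if TubeLemmaThree is
refuted (some ∂H⁵(P) ⊂ ℝ⁵ not isotopic to a 3-convex hypersurface): conv then no longer detects
presentation spheres exactly — restate X₁ as
Bounds₂-existence (EntropyLadder's B) and close this route `superseded --by
route-SmoothPoincare4-EntropyLadder` unless the rung theorems keep it
alive as a support-only line. Mooted if any positive route proves SPC4; if T is proved (anywhere),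
the rung theorem CvxThreeConvexStandard closes by
glue and the route reduces to X₁.

NOT DECOMPOSED YET. The total-absolute-curvature gap carried from
saddle-gap-total-absolute-curvature — τ(f) ≥ 6 for every immersion of an exotic 4-sphere into any
ℝᴺ,
∫|K| ≥ 3·vol(S⁴) and ∫|II|⁴ ≥ 48·vol(S⁴) in ℝ⁵, and the ∫|II|⁴ gap window [16V, 48V) — needs `total
absolute curvature of an immersion`
(definition request) and Chern–Lashof as a named fact; only its Morse core CvxMorseFourStandard is
filed. Rung (b) as an EQUIVALENCE
("3-convexly embeddable ⇔ presentation sphere ⇔ double of a contractible 4-dimensional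
2-handlebody", i.e. TubeLemmaThree) is layer 2.
Sharpe-in-dimension-4 (is inf τ over embeddings Σ⁴ ↪ ℝ⁵ an embedded Morse number? Sharpe1988 covers
m > 5 only) is a side question. The
h-principle side of X₁ (3-convexity is an open Diff-invariant second-order relation on embeddings;
Gromov's directed-embedding theorems cover open
manifolds and immersions only) gets no item until a concrete flexible statement is proposed.
Regularity classes (C^∞ vs C²) and "level set vs
parametrised hypersurface" are bookkeeping.

CHEAPEST FALSIFIER. Two cheap checks, refuters first: (1) the k = 3 TUBE LEMMA on the model 2-handle
— compute the second fundamental form of the smoothed boundary of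
B⁵ ∪ (D²×D³ attached along an unknotted circle in S⁴, either framing) and of a 2-handle cancelling a
1-handle: if the junction cannot be made
3-convex (sum of the three smallest principal curvatures > 0), rung (b) is one-directional, X₁ is
strictly stronger than "presentation sphere" and
the ladder loses its exact middle rung (pivot per Kill criteria); away from junctions the ε-tube of
a 2-disc has curvatures (1/ε, 1/ε, O(1), O(1))
and is 3-convex, so only corners are at stake. (2) LOOKUP: is the 2-generator sector already settled
— are all presentation spheres of 2-generator
balanced presentations of the trivial group (Miller–Schupp, Gordon families) standard in print?
zbMATH searches run here ("balanced presentations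
trivial group homotopy 4-sphere five-dimensional handlebody": 0 hits; the AK(n) family is standard
by Akbulut2010 / GompfAGT2010) found no such
theorem; a positive find collapses rank 4 to support, a recorded exotic candidate sharpens it.

NUMBERS. conv(Σ) ∈ {2, 3, 4} for every embedded homotopy 4-sphere (rungs a–c); SPC4 ⇔ conv ≡ 2.
Morse number: μ(S⁴) = 2, μ(Σ) ∈ {2} ∪ [6, ∞) for homotopy
4-spheres (CvxMorseFourStandard), hence by ChernLashof1957 total absolute curvature τ(f) ≥ 6 for
every immersion of an exotic Σ into ℝᴺ versus
τ = 2 for convex S⁴ ⊂ ℝ⁵; in ℝ⁵: ∫_Σ |K| dV ≥ 3·vol(S⁴) = 8π² (vol(S⁴) = 8π²/3), ∫ over {K < 0} of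
|K| ≥ 8π²/3, ∫ |II|⁴ ≥ 48·vol(S⁴). Sharpe1988: inf τ =
embedded Morse number only for m > 5. Huisken–Sinestrari: 2-convex closed Mⁿ ⊂ ℝⁿ⁺¹, n ≥ 3 ⇒ Sⁿ or
#(Sⁿ⁻¹×S¹). EntropyLadder thresholds for
comparison: λ(S⁴) = 1.4436 < λ(S³×ℝ) = 1.4531 < λ(S²×ℝ²) = 1.4715 < λ(S¹×ℝ³) = 1.5203. Items at
open: 9 (3 cruxes, 5 support, 1 assembly).

DEFINITION REQUESTS. To be filed right after open: (D1) `IsKConvexLevelSet k F` — k-convexity of a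
regular level set of F : EuclideanSpace ℝ (Fin n) → ℝ in the Ky Fan
form inlined above (topic Literature/Geometry/Riemannian), to shorten every item and serve the
entropy / total-curvature lines; (D2)
`totalAbsoluteCurvature` of an immersion of a compact manifold into EuclideanSpace ℝ (Fin N)
(Chern–Lashof: normalised volume swept by the unit
normal bundle under the Gauss map), for the τ ≥ 6 gap. EntropyLadder has already requested the
packaged `Bounds₂` / thickening vocabulary (its D1/D2);
not re-filed. Cite facts wanted: Chern–Lashof τ ≥ μ (ChernLashof1957 Thms 1–3); Sha's p-convexity
theorem (Sha1986 Thm 1); Lawson–Michelsohn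
surrounding theorem (LawsonMichelsohn1984 Thm 1.1); Huisken–Sinestrari classification
(HuiskenSinestrari2008 Thm 1.1 / Cor 1.2).

Novelty: Searches (2026-08-15, this seat; local hybrid index unavailable — searchd reset; OpenAlex 429):
zbMATH `"p-convex Riemannian manifolds"` (6; hit 1 =
Sha1986 doi:10.1007/bf01394417), `"k-convex hypersurfaces topology"` (3, none on handle structure),
`"two-convex embedded spheres moduli space"` (2:
BuzanoHaslhoferHershkovits2021 doi:10.4310/jdg/1622743139, BHH tori doi:10.1093/imrn/rnx125),
`"embedding and surrounding with positive mean curvature"`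
(1: LawsonMichelsohn1984 doi:10.1007/bf01388830), `"total curvature immersed manifolds Chern
Lashof"` (6: doi:10.2307/2372684, doi:10.1307/mmj/1028998005,
Willmore–Saleemi 1966), `"homotopy 4-sphere embedding five-space hypersurface"` (0), `"balanced
presentations trivial group homotopy 4-sphere
five-dimensional handlebody"` (0), `"Morse theory manifolds with boundary height function convex"`
(0 relevant); `lit galaxy search "k-convex
hypersurfaces" --star all` (1: Ma–Ou survey on convexity of level sets of PDE solutions, unrelated),
`lit galaxy search "two-convex hypersurface"
--star all` (timed out, service saturated); plus the card's audited searches (refuter 13-0: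
arXiv:1111.3895 p.6 read, arXiv:1803.06713, arXiv:1905.00809,
arXiv:1507.04651, doi:10.4310/jdg/1214442160). In-ledger: all 14 SPC4 Theses incl. today's
EntropyLadder (shares T; read in full), ConvexBisection,
AlgebraicDegree; cards entropy-ladder-lambda1-rung, doubles-reflection-rung,
saddle-gap-total-absolute-curvature (merged here).
Nearest prior art found: Sha1986 (  [refs: 10.1007/bf01394417, 10.4310/jdg/1622743139, 10.1093/imrn/rnx125, 10.1007/bf01388830, 10.2307/2372684, 10.1307/mmj/1028998005, 10.4310/jdg/1214442160, 10.1007/s00222-008-0148-4, 1111.3895, 1803.06713, 1905.00809, 1507.04651, doi:10.1007/bf01394417, doi:10.4310/jdg/1622743139, doi:10.1093/imrn/rnx125, doi:10.1007/bf01388830, doi:10.2307/2372684, doi:10.1307/mmj/1028998005, doi:10.4310/jdg/1214442160]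

Barriers (technique_class: extrinsic-convexity-ladder, height-function Morse theory): - technique_class: extrinsic-convexity-ladder, height-function Morse theory
- Literature.Barriers.SmoothPoincare4.PropertyTwoRBarrier: not engaged — T asks H⁵(P) ≅ B⁵ with
2/3-handle pairs allowed, which does not force Andrews–Curtis triviality of P (Gompf1991Killing:
Σ_AK(4) ≅ S⁴ while AK(4) is the entry's own AC-nontrivial candidate); no item implies Property 2R or
the Generalised Property R conjecture.
- Literature.Barriers.SmoothPoincare4.StrictPropertyTwoRBarrier: same evasion; the sector crux
concerns the SPHERES of 2-generator presentations, never slides of their links to unlinks.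
- Literature.Barriers.SmoothPoincare4.CircleActionBarrierFour: X₁ would give every Σ a reflection (Σ
= D(W)), a ℤ/2- not an S¹-symmetry; Fintushel–Pao neither applies nor is contradicted (finite groups
are outside the entry, scope caveat (c)).
- Literature.Barriers.SmoothPoincare4.TwistedSphereBarrierFour: used positively only (2 critical
points ⇒ twisted sphere ⇒ S⁴ inside CvxMorseFourStandard); the line never presents Σ as D⁴ ∪_φ D⁴.
- Literature.Barriers.SmoothPoincare4.HCobordismBarrierFour: not engaged — diffeomorphisms come from
handle structures of the 5-dimensional region Ω read off curvature, never from an h-cobordism;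
Θ₄-type facts are not even needed since X₁ supplies the embedding.
- Literature.Barriers.SmoothPoincare4.TopologicalBarrierFour: conv(Σ) is a minimum over smooth
embeddings of a pointwise curvature condition, not an invariant factoring through homeomorphism
type, so fo

History (route lifecycle, newest last):
- 2026-08-23T04:07:54Z · DORMANT — reconciler: no traction for 5.9 d (last activity item-evidence-added at 2026-08-17T06:15:11Z); parked, not closed — `ledger route dormant route-SmoothPoincare4- (operator:999:525033)

sub-problem: SmoothPoincare4 · status: dormant · opened planner-plancard-SmoothPoincare4-SmoothPoinca-0d6cb3a5-0 2026-08-15T11:35:04Z · rev 1 · ledger route-SmoothPoincare4-ConvexityLadder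
GENERATED by the gate from the ledger (D-0016/17). Provers cite these decls: `theorem foo : Summit.SmoothPoincare4.SmoothPoincare4.Theses.ConvexityLadder.<Decl> := …` in Summits/SmoothPoincare4/SmoothPoincare4/Theorems/<Name>.lean.
-/

namespace Summit.SmoothPoincare4.SmoothPoincare4.Theses.ConvexityLadder

open scoped BigOperators Topology Manifold Classical MeasureTheory ProbabilityTheory Matrix InnerProductSpace ComplexConjugate ContinuousMap ContDiff
open Filter Set Function TopologicalSpace MeasureTheory

attribute [summit_statement] _root_.SmoothPoincare4

open Literature.SPC4

/-- item stmt-SmoothPoincare4-4785 · crux · rank 2 · open · by planner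
why it might fail: Forces every homotopy 4-sphere to bound a contractible 2-handlebody, i.e. to be a double D(W) with an orientation-reversing involution; a Gluck-twist or zero-surgery sphere that is no presentation sphere (conv = 4) refutes it, and no engine (flow, closed-case h-principle) yet makes 3-convexity.
sources: Sha1986, LawsonMichelsohn1984, AndrewsCurtis1965, AkbulutKirby1985, arXiv:1803.06713, arXiv:1111.3895
[crux] every smooth 4-manifold M ≃ₕ S⁴ admits a 3-convex embedding into ℝ⁵ — a smooth F : ℝ⁵ → ℝ
with compact {F ≤ 0} and DF ≠ 0 on {F = 0}, a smooth embedding e : M → ℝ⁵ onto {F = 0}, and Σᵢ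
D²F(x)(vᵢ,vᵢ) > 0 for every x ∈ {F = 0} and every orthonormal triple (v₁,v₂,v₃) ⊂ ker DF(x) (card
crux I; ⇒ M bounds a contractible 5-dimensional 2-handlebody by the bridge, conversely modulo the k
= 3 tube lemma; so X₁ ⇔ EntropyLadder's B ⇔ its E modulo glue). [difficulty: open-problem] -/
@[route_item "route-SmoothPoincare4-ConvexityLadder", crux]
def CvxThreeConvexEmbeds : Prop :=
  ∀ (M : Type) [TopologicalSpace M] [T2Space M] [SecondCountableTopology M] [ChartedSpace (EuclideanSpace ℝ (Fin 4)) M] [IsManifold (𝓡 4) ∞ M], M ≃ₕ Metric.sphere (0 : EuclideanSpace ℝ (Fin 5)) 1 → ∃ (F : EuclideanSpace ℝ (Fin 5) → ℝ) (e : M → EuclideanSpace ℝ (Fin 5)), ContDiff ℝ ∞ F ∧ IsCompact {x | F x ≤ 0} ∧ (∀ x, F x = 0 → fderiv ℝ F x ≠ 0) ∧ Manifold.IsSmoothEmbedding (𝓡 4) 𝓘(ℝ, EuclideanSpace ℝ (Fin 5)) ∞ e ∧ Set.range e = {x | F x = 0} ∧ ∀ x, F x = 0 → ∀ v : Fin 3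 → EuclideanSpace ℝ (Fin 5), Orthonormal ℝ v → (∀ i, fderiv ℝ F x (v i) = 0) → 0 < ∑ i, iteratedFDeriv ℝ 2 F x ![v i, v i]

/-- item stmt-SmoothPoincare4-3717 · crux · rank 3 · open · by planner
why it might fail: It is the 5-dimensional Andrews–Curtis problem: H⁵(P) ≅ B⁵ is known only for AC-trivial P and the Akbulut–Kirby family (Gompf 1991, Akbulut 2010); one balanced presentation of the trivial group with exotic ∂H⁵(P) refutes it and SPC4 at once.
sources: AndrewsCurtis1965, AkbulutKirby1985, Gompf1991Killing, Akbulut2010, GompfScharlemannThompson2010, arXiv:1905.00809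
[crux] T (card item R3-TOP): a homotopy 4-sphere M that bounds a compact contractible smooth
5-manifold W admitting a Morse function adapted to ∂W all of whose critical points have index ≤ 2
(`IsHandlebodyOfIndexLE 4 2 W` unfolded; W = H⁵(P,ε) for a balanced presentation P of the trivial
group after 0/1-cancellation) is diffeomorphic to S⁴. Equivalent forms: every compact contractible
5-dimensional 2-handlebody is B⁵ (∂W ≅ S⁴ ⇒ W ∪ B⁵ ≅ S⁵ ⇒ W ≅ B⁵); ∂H⁵(P,ε) ≅ S⁴ for all (P,ε);
doubles D(Δ) = ∂(Δ×I) of contractible 4-dimensional 2-handlebodies are S⁴ (shared with card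
doubles-reflection-rung). Known: P Andrews–Curtis trivial ⇒ H⁵(P,ε) ≅ B⁵ [AndrewsCurtis1965]; the
Akbulut–Kirby/GST family ⟨x,y | xyx=yxy, xⁿ⁺¹=yⁿ⟩ ⇒ standard [Gompf1991Killing]. [difficulty:
open-problem] -/
@[route_item "route-SmoothPoincare4-ConvexityLadder", crux]
def PresentationSpheresStandard : Prop :=
  ∀ (M : Type) [TopologicalSpace M] [T2Space M] [SecondCountableTopology M] [ChartedSpace (EuclideanSpace ℝ (Fin 4)) M] [IsManifold (𝓡 4) ∞ M], M ≃ₕ Metric.sphere (0 : EuclideanSpace ℝ (Fin 5)) 1 → (∃ (W : Type) (_ : TopologicalSpace W) (_ : T2Space W) (_ : SecondCountableTopology W) (_ : ChartedSpace (EuclideanHalfSpace (4 + 1)) W) (_ : IsManifold (𝓡∂ (4 + 1)) ∞ W) (_ : CompactSpace W), ContractibleSpace W ∧ (∃ f : W → ℝ, Literature.Topology.FourManifolds.IsMorseAdapted (𝓡∂ (4 + 1)) f ∧ ∀ z, Literature.Topology.FourManifolds.IsMCriticalPt (𝓡∂ (4 + 1)) f z → Literature.Topology.FourManifolds.morseIndex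 (𝓡∂ (4 + 1)) f z ≤ 2) ∧ ∃ φ : M → W, Manifold.IsSmoothEmbedding (𝓡 4) (𝓡∂ (4 + 1)) ∞ φ ∧ Set.range φ = (𝓡∂ (4 + 1)).boundary W) → Nonempty (M ≃ₘ⟮𝓡 4, 𝓡 4⟯ Metric.sphere (0 : EuclideanSpace ℝ (Fin 5)) 1)

/-- item stmt-SmoothPoincare4-4786 · crux · rank 4 · open · by planner
why it might fail: ≤ 1 generator is trivial, but 2-generator balanced presentations of the trivial group include AK(n) (spheres standard only by Gompf 1991 / Akbulut 2010) and Miller–Schupp-type families expected AC-nontrivial whose spheres nobody has standardised; an exotic one is ¬SPC4.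
sources: Akbulut2010, Gompf1991Killing, GompfScharlemannThompson2010, MeierZupan2022, AkbulutKirby1985
[crux] first open sector of T: the same with the adapted Morse function on W having exactly ONE
critical point of index 0 and AT MOST TWO of index 1 (so W = B⁵ ∪ ≤ 2 one-handles ∪ as many
2-handles, χ(W) = 1: the presentation spheres of balanced presentations of the trivial group on ≤ 2
generators) ⇒ M ≅ S⁴. In convexity currency: 3-convex Σ whose some height function has one Ω-inward
minimum and ≤ 2 Ω-inward index-1 points. [deps: PresentationSpheresStandard] [difficulty: L] -/
@[route_item "route-SmoothPoincare4-ConvexityLadder"]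
def TwoGeneratorPresentationSpheres : Prop :=
  ∀ (M : Type) [TopologicalSpace M] [T2Space M] [SecondCountableTopology M] [ChartedSpace (EuclideanSpace ℝ (Fin 4)) M] [IsManifold (𝓡 4) ∞ M], M ≃ₕ Metric.sphere (0 : EuclideanSpace ℝ (Fin 5)) 1 → (∃ (W : Type) (_ : TopologicalSpace W) (_ : T2Space W) (_ : SecondCountableTopology W) (_ : ChartedSpace (EuclideanHalfSpace (4 + 1)) W) (_ : IsManifold (𝓡∂ (4 + 1)) ∞ W) (_ : CompactSpace W), ContractibleSpace W ∧ (∃ f : W → ℝ, Literature.Topology.FourManifolds.IsMorseAdapted (𝓡∂ (4 + 1)) f ∧ (∀ z, Literature.Topology.FourManifolds.IsMCriticalPt (𝓡∂ (4 + 1)) f z → Literature.Topology.FourManifolds.morseIndex (𝓡∂ (4 + 1)) f z ≤ 2) ∧ (Literature.Topology.FourManifolds.criticalSetOfIndex (𝓡∂ (4 + 1)) f 0).ncard = 1 ∧ (Literature.Topology.FourManifolds.criticalSetOfIndex (𝓡∂ (4 + 1)) f 1).ncard ≤ 2) ∧ ∃ φ : M → W, Manifold.IsSmoothEmbedding (𝓡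 4) (𝓡∂ (4 + 1)) ∞ φ ∧ Set.range φ = (𝓡∂ (4 + 1)).boundary W) → Nonempty (M ≃ₘ⟮𝓡 4, 𝓡 4⟯ Metric.sphere (0 : EuclideanSpace ℝ (Fin 5)) 1)

/-- item stmt-SmoothPoincare4-4787 · support · rank 9 · open · by planner
sources: Sha1986, Milnor1965, Matsumoto2001, GuilleminPollack2010, arXiv:1111.3895
[support] the BRIDGE (in the assembly; known mathematics, long formalisation): if M ≃ₕ S⁴ carries
the data (F, e) of a 3-convex embedding into ℝ⁵ then M bounds a compact contractible smooth
5-manifold with an adapted Morse function of index ≤ 2 (EntropyLadder's Bounds₂(M), same spelling).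
Proof: Ω = {F ≤ 0} is a compact 5-manifold with ∂Ω = {F = 0} = e(M); for a.e. direction a the height
⟨a,·⟩ is Morse on ∂Ω (Literature MorseHeightFunctions) with no interior critical points; passing an
Ω-inward horizontal point (DF·a < 0) attaches a handle of index = Morse index = number of negative
eigenvalues of D²F|ker DF ≤ 2 by 3-convexity, other horizontal points attach nothing (Sha1986 /
Morse theory on manifolds with boundary); handles ⇒ adapted Morse function (Kosinski VII); Ω is
contractible (van Kampen + Mayer–Vietoris in S⁵ = Ω ∪_Σ Ω'). [difficulty: L] -/
@[route_item "route-SmoothPoincare4-ConvexityLadder", crux]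
def CvxThreeConvexBoundsTwoHandlebody : Prop :=
  ∀ (M : Type) [TopologicalSpace M] [T2Space M] [SecondCountableTopology M] [ChartedSpace (EuclideanSpace ℝ (Fin 4)) M] [IsManifold (𝓡 4) ∞ M], M ≃ₕ Metric.sphere (0 : EuclideanSpace ℝ (Fin 5)) 1 → ∀ (F : EuclideanSpace ℝ (Fin 5) → ℝ) (e : M → EuclideanSpace ℝ (Fin 5)), ContDiff ℝ ∞ F → IsCompact {x | F x ≤ 0} → (∀ x, F x = 0 → fderiv ℝ F x ≠ 0) → Manifold.IsSmoothEmbedding (𝓡 4) 𝓘(ℝ, EuclideanSpace ℝ (Fin 5)) ∞ e → Set.range e = {x | F x = 0} → (∀ x, F x = 0 → ∀ v : Fin 3 → EuclideanSpace ℝ (Fin 5), Orthonormal ℝ v → (∀ i, fderiv ℝ F x (v i) = 0) → 0 < ∑ i, iteratedFDeriv ℝ 2 F x ![v i, v i]) → ∃ (W : Type) (_ : TopologicalSpace W) (_ : T2Space W) (_ : SecondCountableTopology W) (_ : ChartedSpace (EuclideanHalfSpace (4 + 1)) W) (_ : IsManifold (𝓡∂ (4 + 1)) ∞ W) (_ :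 CompactSpace W), ContractibleSpace W ∧ (∃ f : W → ℝ, Literature.Topology.FourManifolds.IsMorseAdapted (𝓡∂ (4 + 1)) f ∧ ∀ z, Literature.Topology.FourManifolds.IsMCriticalPt (𝓡∂ (4 + 1)) f z → Literature.Topology.FourManifolds.morseIndex (𝓡∂ (4 + 1)) f z ≤ 2) ∧ ∃ φ : M → W, Manifold.IsSmoothEmbedding (𝓡 4) (𝓡∂ (4 + 1)) ∞ φ ∧ Set.range φ = (𝓡∂ (4 + 1)).boundary W

/-- item stmt-SmoothPoincare4-4788 · support · rank 9 · open · by planner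
sources: Sha1986, AndrewsCurtis1965, Gompf1991Killing
[support] the RUNG THEOREM of this route (= bridge ∧ T; glue `CvxThreeConvexBoundsTwoHandlebody →
PresentationSpheresStandard → CvxThreeConvexStandard` proved in Sketch.lean): a smooth 4-manifold M
≃ₕ S⁴ with a 3-convex embedding into ℝ⁵ is diffeomorphic to S⁴. Publishable milestone independent of
X₁; refuter-facing form of T in convexity currency. [difficulty: open-problem] -/
@[route_item "route-SmoothPoincare4-ConvexityLadder"]
def CvxThreeConvexStandard : Prop :=
  ∀ (M : Type) [TopologicalSpace M] [T2Space M] [SecondCountableTopology M] [ChartedSpace (EuclideanSpace ℝ (Fin 4)) M] [IsManifold (𝓡 4) ∞ M], M ≃ₕ Metric.sphere (0 : EuclideanSpace ℝ (Fin 5)) 1 → ∀ (F : EuclideanSpace ℝ (Fin 5) → ℝ) (e : M → EuclideanSpace ℝ (Fin 5)), ContDiff ℝ ∞ F → IsCompact {x | F x ≤ 0} → (∀ x, F x = 0 → fderiv ℝ F x ≠ 0) → Manifold.IsSmoothEmbedding (𝓡 4) 𝓘(ℝ, EuclideanSpace ℝ (Fin 5)) ∞ e → Set.range e = {x | F x =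 0} → (∀ x, F x = 0 → ∀ v : Fin 3 → EuclideanSpace ℝ (Fin 5), Orthonormal ℝ v → (∀ i, fderiv ℝ F x (v i) = 0) → 0 < ∑ i, iteratedFDeriv ℝ 2 F x ![v i, v i]) → Nonempty (M ≃ₘ⟮𝓡 4, 𝓡 4⟯ Metric.sphere (0 : EuclideanSpace ℝ (Fin 5)) 1)

/-- item stmt-SmoothPoincare4-4789 · support · rank 9 · open · by planner
sources: Sha1986, HuiskenSinestrari2008, BuzanoHaslhoferHershkovits2021
[support] rung (a): a 2-convexly embedded M ≃ₕ S⁴ in ℝ⁵ (orthonormal PAIRS in the convexity clause)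
is diffeomorphic to S⁴ — height-function Morse theory makes Ω a 5-dimensional 1-handlebody ♮ₖ(S¹×B⁴)
with simply connected boundary, so k = 0, Ω ≅ B⁵, M ≅ ∂B⁵; alternatively Huisken–Sinestrari's
classification of closed 2-convex hypersurfaces (n = 4: S⁴ or #(S³×S¹)). Known; long to formalise.
[difficulty: L] -/
@[route_item "route-SmoothPoincare4-ConvexityLadder"]
def CvxTwoConvexStandard : Prop :=
  ∀ (M : Type) [TopologicalSpace M] [T2Space M] [SecondCountableTopology M] [ChartedSpace (EuclideanSpace ℝ (Fin 4)) M] [IsManifold (𝓡 4) ∞ M], M ≃ₕ Metric.sphere (0 : EuclideanSpace ℝ (Fin 5)) 1 → ∀ (F : EuclideanSpace ℝ (Fin 5) → ℝ) (e : M → EuclideanSpace ℝ (Fin 5)), ContDiff ℝ ∞ F → IsCompact {x | F x ≤ 0} → (∀ x, F x = 0 → fderiv ℝ F x ≠ 0) → Manifold.IsSmoothEmbedding (𝓡 4) 𝓘(ℝ, EuclideanSpace ℝ (Fin 5)) ∞ e → Set.range e = {x | F x = 0} → (∀ x, F x = 0 → ∀ v : Fin 2 → EuclideanSpace ℝ (Fin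 5), Orthonormal ℝ v → (∀ i, fderiv ℝ F x (v i) = 0) → 0 < ∑ i, iteratedFDeriv ℝ 2 F x ![v i, v i]) → Nonempty (M ≃ₘ⟮𝓡 4, 𝓡 4⟯ Metric.sphere (0 : EuclideanSpace ℝ (Fin 5)) 1)

/-- item stmt-SmoothPoincare4-4790 · support · rank 9 · open · by planner
sources: Gabai1987, LaudenbachPoenaru1972, Cerf1968, Reeb1952, ChernLashof1957, Sharpe1988
[support] Morse-number rung under the card's crux III and the merged card
saddle-gap-total-absolute-curvature: a compact smooth M ≃ₕ S⁴ with a Morse function having finitely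
many, at most 4, critical points is diffeomorphic to S⁴ (indices (0,2,3,4) or dual: the 2-handle's
framed knot has surgery S¹×S², so it is the 0-framed unknot by Property R, then Laudenbach–Poenaru;
2 critical points: Reeb + Cerf Γ₄ = 0). With Chern–Lashof (τ = mean number of height-function
critical points) it yields τ ≥ 6, ∫|K| ≥ 3·vol(S⁴), for every immersion of an exotic 4-sphere —
recorded under Not decomposed yet. [difficulty: L] -/
@[route_item "route-SmoothPoincare4-ConvexityLadder"]
def CvxMorseFourStandard : Prop :=
  ∀ (M : Type) [TopologicalSpace M] [T2Space M] [SecondCountableTopology M] [ChartedSpace (EuclideanSpace ℝ (Fin 4)) M] [IsManifold (𝓡 4) ∞ M] [CompactSpace M], M ≃ₕ Metric.sphere (0 : EuclideanSpace ℝ (Fin 5)) 1 → ∀ f : M → ℝ, Literature.Topology.FourManifolds.IsMorse (𝓡 4) f → (Literature.Topology.FourManifolds.criticalSet (𝓡 4) f).Finite → (Literature.Topology.FourManifolds.criticalSet (𝓡 4) f).ncard ≤ 4 → Nonempty (M ≃ₘ⟮𝓡 4, 𝓡 4⟯ Metric.sphere (0 : EuclideanSpace ℝ (Fin 5)) 1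)

/-- item stmt-SmoothPoincare4-4791 · support · rank 9 · open · by planner
sources: LawsonMichelsohn1984, Milnor1965, KervaireMilnor1963
[support] rung (c), top of the ladder: an M ≃ₕ S⁴ presented as a compact regular zero set in ℝ⁵ also
admits a MEAN-convex such presentation (orthonormal 4-frames: trace of D²F on ker DF positive): Ω is
contractible, its 4-handles are traded for 2-handles rel the simply connected boundary (dimension
5), so Ω is a regular neighbourhood of a 3-complex, codimension 2, and Lawson–Michelsohn surround it
by a hypersurface of positive mean curvature. Hence conv ∈ {2,3,4} for every embedded homotopy
4-sphere. [difficulty: M] -/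
@[route_item "route-SmoothPoincare4-ConvexityLadder"]
def CvxMeanConvexRepresentative : Prop :=
  ∀ (M : Type) [TopologicalSpace M] [T2Space M] [SecondCountableTopology M] [ChartedSpace (EuclideanSpace ℝ (Fin 4)) M] [IsManifold (𝓡 4) ∞ M], M ≃ₕ Metric.sphere (0 : EuclideanSpace ℝ (Fin 5)) 1 → ∀ (F : EuclideanSpace ℝ (Fin 5) → ℝ) (e : M → EuclideanSpace ℝ (Fin 5)), ContDiff ℝ ∞ F → IsCompact {x | F x ≤ 0} → (∀ x, F x = 0 → fderiv ℝ F x ≠ 0) → Manifold.IsSmoothEmbedding (𝓡 4) 𝓘(ℝ, EuclideanSpace ℝ (Fin 5)) ∞ e → Set.range e = {x | F x = 0} → ∃ (F' : EuclideanSpace ℝ (Fin 5) → ℝ) (e' : M → EuclideanSpace ℝ (Fin 5)), ContDiff ℝ ∞ F' ∧ IsCompact {x | F' x ≤ 0} ∧ (∀ x, F' x = 0 → fderiv ℝ F' x ≠ 0) ∧ Manifold.IsSmoothEmbedding (𝓡 4) 𝓘(ℝ, EuclideanSpace ℝ (Fin 5)) ∞ e' ∧ Set.range e' = {x | F' x =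 0} ∧ ∀ x, F' x = 0 → ∀ v : Fin 4 → EuclideanSpace ℝ (Fin 5), Orthonormal ℝ v → (∀ i, fderiv ℝ F' x (v i) = 0) → 0 < ∑ i, iteratedFDeriv ℝ 2 F' x ![v i, v i]

/-- item stmt-SmoothPoincare4-4792 · assembly · rank 1 · open · by planner
sources: Sha1986, AndrewsCurtis1965
[assembly] CvxThreeConvexEmbeds → CvxThreeConvexBoundsTwoHandlebody → PresentationSpheresStandard →
SmoothPoincare4. -/
@[route_item "route-SmoothPoincare4-ConvexityLadder"]
def Assembly : Prop :=
  CvxThreeConvexEmbeds → CvxThreeConvexBoundsTwoHandlebody → PresentationSpheresStandard → SmoothPoincare4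

/-! D-0027 §2.1 — DECIDING THEOREM (planner-authored via `route open/edit --closes-file`; by planner-rbadge-SmoothPoincare4-ConvexityLadder-598bf4a1-g4-0 2026-08-15T16:10:26Z):
its hypotheses are this route's items and its conclusion the sub-problem Statement (glue_lint), and it elaborates with this file. -/

@[closes "route-SmoothPoincare4-ConvexityLadder"] theorem closes (hE : CvxThreeConvexEmbeds) (hB : CvxThreeConvexBoundsTwoHandlebody)
    (hT : PresentationSpheresStandard) : _root_.SmoothPoincare4 := by
  unfold _root_.SmoothPoincare4 Literature.SPC4.SmoothPoincareConjectureFour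
    ContinuousMap.HomotopyEquiv.NonemptyDiffeomorphSphere
  intro M _ _ _ _ _ e
  obtain ⟨F, emb, hF, hK, hreg, he, hr, hcvx⟩ := hE M e
  exact hT M e (hB M e F emb hF hK hreg he hr hcvx)

end Summit.SmoothPoincare4.SmoothPoincare4.Theses.ConvexityLadder
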